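import Summits.ValiantsHypothesis.ValiantsHypothesis.Theorems.LacunarySymmetroidMatrixDescartesCensusPivotKit

/-!
# `MatrixDescartes` census — pivot column: the REVERSAL LAW `x ↦ 1/x` for pivot pencils of every size
# `pivotPosRoots (N − e) (N − d) J P = pivotPosRoots e d J P`

HONEST FRAMING.  Object-search cell `pub-symmetroid`, Conjecture-B column in PIVOT currency (`…CensusPivotDefs.lean`, seat conjb-1),
seat `val-sym-mdr-p1` (generation 6).  Helper file landed `--supports` the crux item stmt-ValiantsHypothesis-18050
(`Theses.LacunarySymmetroid.MatrixDescartes`, OPEN, on HOLD) with NO closure claim.  A bookkeeping law about ONE arbitrary pivot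
pencil `F = X^e J + ∑ X^{dₖ} Pₖ` of ANY size `m`, ANY `K`, ANY real matrices `J, Pₖ` (no symmetry, no semidefiniteness used): for
`N` at least every exponent, the REVERSED pencil `F^♭ = X^{N−e} J + ∑ X^{N−dₖ} Pₖ` satisfies `F^♭(t) = t^N · F(1/t)` for `t > 0`, hence
`det F^♭(t) = t^{Nm} det F(1/t)` (`eval_det_pivot_reverse`) and `x ↦ 1/x` is a bijection between the distinct positive determinant
roots of `F` and of `F^♭`: **`pivotPosRoots (N − e) (N − d ·) J P = pivotPosRoots e d J P`** (`pivotPosRoots_reverse`).  This is the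
general form of the four-letter reversal `WLawTwoSix.reflect_det_wPencil` (seat g5, by explicit monomials) and of the one-sided
`stub_reverse` used in `…CensusPivotIndexRung`; it turns every chamber theorem of shape `(p | r)` (letters below | above the pivot)
into its mirror `(r | p)` — e.g. the seat's located census of the `(2,4)` row pairs the 100 `V = 10` order types this way.
Nothing here bears on `Theses.LacunarySymmetroid.MatrixDescartes` in its window, on `KPlusLogSqLaw`, on `DoorA26` / `DoorA34`, on the
cell's registers or credences, or on `VP ≠ VNP`.

[folklore] Elementary (`det (c • M) = c^m det M`, `Polynomial.eq_zero_of_infinite_isRoot`); tree `Pivot.eval_det_pivot`.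
No definitions, no named facts.
-/

-- `Summit.ValiantsHypothesis.ValiantsHypothesis.…` repeats a component by the D-0017 layout
-- (single-conjunct summit), which the `dupNamespace` linter flags; the name is mandated.
set_option linter.dupNamespace false

namespace Summit.ValiantsHypothesis.ValiantsHypothesis.Theorems.LacunarySymmetroidMatrixDescartes.Pivot.Reverse

open Matrix Finset Polynomial
open scoped BigOperators

variable {m K : ℕ}

/-- **The reversed pencil at `t` is `t^N · F(1/t)`** (`t ≠ 0`, `N` at least every exponent). [folklore] -/
theorem eval_pencil_reverse (N e : ℕ) (d : Fin K → ℕ) (J : Matrix (Fin m) (Fin m) ℝ)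
    (P : Fin K → Matrix (Fin m) (Fin m) ℝ) (he : e ≤ N) (hd : ∀ k, d k ≤ N) {t : ℝ} (ht : t ≠ 0) :
    t ^ (N - e) • J + ∑ k, t ^ (N - d k) • P k = t ^ N • (t⁻¹ ^ e • J + ∑ k, t⁻¹ ^ d k • P k) := by
  have hpow : ∀ {c : ℕ}, c ≤ N → t ^ (N - c) = t ^ N * t⁻¹ ^ c := by
    intro c hc
    rw [inv_pow, pow_sub₀ t ht hc]
  rw [smul_add, smul_smul, Finset.smul_sum, ← hpow he]
  congr 1
  exact Finset.sum_congr rfl fun k _ => by rw [smul_smul, ← hpow (hd k)]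

/-- **`det F^♭(t) = t^{Nm} · det F(1/t)`** for `t ≠ 0`. [folklore] -/
theorem eval_det_pivot_reverse (N e : ℕ) (d : Fin K → ℕ) (J : Matrix (Fin m) (Fin m) ℝ)
    (P : Fin K → Matrix (Fin m) (Fin m) ℝ) (he : e ≤ N) (hd : ∀ k, d k ≤ N) {t : ℝ} (ht : t ≠ 0) :
    (Matrix.det (((X : ℝ[X]) ^ (N - e)) • J.map Polynomial.C
        + ∑ k, ((X : ℝ[X]) ^ (N - d k)) • (P k).map Polynomial.C)).eval t
      = (t ^ N) ^ m * (Matrix.det (((X : ℝ[X]) ^ e) • J.map Polynomial.C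
        + ∑ k, ((X : ℝ[X]) ^ d k) • (P k).map Polynomial.C)).eval t⁻¹ := by
  rw [eval_det_pivot, eval_det_pivot, eval_pencil_reverse N e d J P he hd ht, Matrix.det_smul, Fintype.card_fin]

/-- If the reversed determinant is the zero polynomial, so is the original one. [folklore] -/
theorem det_eq_zero_of_det_reverse_eq_zero (N e : ℕ) (d : Fin K → ℕ) (J : Matrix (Fin m) (Fin m) ℝ)
    (P : Fin K → Matrix (Fin m) (Fin m) ℝ) (he : e ≤ N) (hd : ∀ k, d k ≤ N)
    (h : Matrix.det (((X : ℝ[X]) ^ (N - e)) • J.map Polynomial.C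
        + ∑ k, ((X : ℝ[X]) ^ (N - d k)) • (P k).map Polynomial.C) = 0) :
    Matrix.det (((X : ℝ[X]) ^ e) • J.map Polynomial.C + ∑ k, ((X : ℝ[X]) ^ d k) • (P k).map Polynomial.C) = 0 := by
  apply Polynomial.eq_zero_of_infinite_isRoot
  refine Set.Infinite.mono (s := Set.Ioi (0 : ℝ)) (fun s hs => ?_) (Set.Ioi_infinite 0)
  have hs0 : (s : ℝ) ≠ 0 := ne_of_gt hs
  have key := eval_det_pivot_reverse N e d J P he hd (inv_ne_zero hs0)
  rw [h, eval_zero, inv_inv] at key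
  have hpow : ((s⁻¹ ^ N) ^ m : ℝ) ≠ 0 := pow_ne_zero _ (pow_ne_zero _ (inv_ne_zero hs0))
  simp only [Set.mem_setOf_eq, IsRoot.def]
  exact (mul_eq_zero.mp key.symm).resolve_left hpow

/-- One direction of the bijection: `x ↦ 1/x` maps the distinct positive roots of `det F` injectively into those of
`det F^♭`, so `Z₊(F) ≤ Z₊(F^♭)`. [folklore] -/
theorem pivotPosRoots_le_pivotPosRoots_reverse (N e : ℕ) (d : Fin K → ℕ) (J : Matrix (Fin m) (Fin m) ℝ)
    (P : Fin K → Matrix (Fin m) (Fin m) ℝ) (he : e ≤ N) (hd : ∀ k, d k ≤ N) :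
    pivotPosRoots e d J P ≤ pivotPosRoots (N - e) (fun k => N - d k) J P := by
  classical
  unfold pivotPosRoots
  set f := Matrix.det (((X : ℝ[X]) ^ e) • J.map Polynomial.C + ∑ k, ((X : ℝ[X]) ^ d k) • (P k).map Polynomial.C)
    with hf
  set g := Matrix.det (((X : ℝ[X]) ^ (N - e)) • J.map Polynomial.C
    + ∑ k, ((X : ℝ[X]) ^ (N - d k)) • (P k).map Polynomial.C) with hg
  by_cases hg0 : g = 0
  · have hf0 : f = 0 := det_eq_zero_of_det_reverse_eq_zero N e d J P he hd hg0
    rw [hf0, Polynomial.roots_zero]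
    simp
  have hf0 : f ≠ 0 := by
    intro h0
    -- then `g` vanishes on `(0, ∞)`, contradiction with `g ≠ 0`
    apply hg0
    apply Polynomial.eq_zero_of_infinite_isRoot
    refine Set.Infinite.mono (s := Set.Ioi (0 : ℝ)) (fun s hs => ?_) (Set.Ioi_infinite 0)
    have key := eval_det_pivot_reverse N e d J P he hd (ne_of_gt hs)
    simp only [Set.mem_setOf_eq, IsRoot.def]
    rw [← hg, ← hf] at key
    rw [key, h0, eval_zero, mul_zero]
  refine Finset.card_le_card_of_injOn (fun x => x⁻¹) (fun x hx => ?_) (fun x _ y _ hxy => inv_injective hxy)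
  simp only [Finset.coe_filter, Set.mem_setOf_eq, Multiset.mem_toFinset, mem_roots hf0, mem_roots hg0, IsRoot.def]
    at hx ⊢
  obtain ⟨hfx, hx0⟩ := hx
  refine ⟨?_, inv_pos.mpr hx0⟩
  have key := eval_det_pivot_reverse N e d J P he hd (inv_ne_zero hx0.ne')
  rw [← hg, ← hf, inv_inv, hfx, mul_zero] at key
  exact key

/-- **REVERSAL LAW** (every size `m`, every `K`, any real `J, Pₖ`): for `N` at least every exponent,
`pivotPosRoots (N − e) (N − d ·) J P = pivotPosRoots e d J P` — the pencils `X^e J + ∑ X^{dₖ} Pₖ` and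
`X^{N−e} J + ∑ X^{N−dₖ} Pₖ` have the same number of distinct positive determinant roots (`x ↦ 1/x`). [folklore] -/
theorem pivotPosRoots_reverse (N e : ℕ) (d : Fin K → ℕ) (J : Matrix (Fin m) (Fin m) ℝ)
    (P : Fin K → Matrix (Fin m) (Fin m) ℝ) (he : e ≤ N) (hd : ∀ k, d k ≤ N) :
    pivotPosRoots (N - e) (fun k => N - d k) J P = pivotPosRoots e d J P := by
  refine le_antisymm ?_ (pivotPosRoots_le_pivotPosRoots_reverse N e d J P he hd)
  have h := pivotPosRoots_le_pivotPosRoots_reverse N (N - e) (fun k => N - d k) J P (Nat.sub_le N e)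
    (fun k => Nat.sub_le N (d k))
  have h1 : N - (N - e) = e := Nat.sub_sub_self he
  have h2 : (fun k => N - (N - d k)) = d := funext fun k => Nat.sub_sub_self (hd k)
  rw [h1, h2] at h
  exact h

/-- **Mirror rows.**  A bound `Z₊ ≤ B` for the pencil with exponents `(e, d)` is the same statement for the mirrored exponents
`(N − e, N − d)`: chamber theorems of shape `(p | r)` (letters below | above the pivot) transfer to shape `(r | p)`. [folklore] -/
theorem pivotPosRoots_le_iff_reverse (N e : ℕ) (d : Fin K → ℕ) (J : Matrix (Fin m) (Fin m) ℝ)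
    (P : Fin K → Matrix (Fin m) (Fin m) ℝ) (he : e ≤ N) (hd : ∀ k, d k ≤ N) (B : ℕ) :
    pivotPosRoots (N - e) (fun k => N - d k) J P ≤ B ↔ pivotPosRoots e d J P ≤ B := by
  rw [pivotPosRoots_reverse N e d J P he hd]

end Summit.ValiantsHypothesis.ValiantsHypothesis.Theorems.LacunarySymmetroidMatrixDescartes.Pivot.Reverse
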